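import Mathlib.Analysis.Calculus.Gradient.Basic
import Mathlib.Analysis.Calculus.Deriv.Basic
import Mathlib.Analysis.InnerProductSpace.Calculus
import Mathlib.MeasureTheory.Integral.IntervalIntegral.Basic
import Mathlib.Dynamics.Ergodic.MeasurePreserving
import Literature.Analysis.FluidPDE.HardSpherePhaseSpace
import HarnessLib

/-!
# Soft-sphere `N`-body dynamics: the everywhere-defined Newtonian flow of a bounded `C²` radial pair potential

Topic `Analysis/FunctionSpaces`, companion of `PotentialDynamics.lean` (`ShortRangePotential`,
`PotentialFlow`: a SINGULAR repulsive profile `φ → +∞` at `0⁺`, hence a good-set hypothesis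
structure). Requested by the definition item `defn-SoftSphereFlow` of route
`AtomisticToContinuum/SoftShoulderLandauDial` (item WindowEuler and its rungs), whose typed
statements inline the three axioms below for the soft-shoulder profiles `h · ψ(|x| / σ_N)`
(`ψ` of class `C²`, `= 1` on `[0, ½]`, `= 0` on `[1, ∞)`). Definitions + proved API; NO named
facts (existence / uniqueness / Liouville / energy conservation for the concrete geometries are
standard theorems — Cauchy–Lipschitz with a bounded globally Lipschitz force, Liouville's theorem
— to be vendored or proved separately when a consumer needs them; they are NOT fields, exactly as
the route inlines only the three axioms).

* `SoftPotential d` — a **bounded `C²` radial pair potential of range `1`**: `W : ℝ^d → ℝ` of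
  class `C²` on all of `ℝ^d` (so the force is bounded and globally Lipschitz: no singular core),
  radial (`|x| = |y| → W x = W y`) and vanishing for `|x| ≥ 1`; `W.scaled ε x = W (ε⁻¹ • x)`
  (range `ε`). `SoftPotential.ofProfile ψ h …` builds it from a `C²` profile `ψ : ℝ → ℝ` which is
  CONSTANT near `0` (as the route's shoulder `ψ = 1` on `[0, ½]`) — the condition under which
  `x ↦ c · ψ |x|` is `C²` at the origin (`contDiff_profile_norm`).
* `softForce G W ε z i = -∑_{j ≠ i} ∇W_ε (sepVec x_i x_j)`, `softEnergy` (kinetic + `∑_{i<j} W_ε`),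
  `IsSoftTrajectory G W ε N γ` (Newton's law for the velocities, positions by translating along
  the integrated velocity — verbatim the shape of `IsHamiltonianTrajectory`), and
* **`SoftSphereFlow G W ε N`** — the structure with fields `flow : ℝ → Config N d X → Config N d X`,
  `flow_zero : ∀ z, flow 0 z = z`, `isTrajectory : ∀ z, IsSoftTrajectory G W ε N (flow · z)`:
  an EVERYWHERE-defined flow (every initial datum), the three axioms the route's rungs
  (`WindowEuler`, `EquilibriumDecorrelation`, `SmallHeightAccuracy`, `SoftLorentzIsotropisation`)
  inline for their families `Ψ_N`; `transportFn`, `lawAt` as for `PotentialFlow`.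
* API (proved): `SoftPotential.continuous`, `.exists_bound` (`W` is bounded), `.scaled_eq_zero`
  (no interaction beyond range `ε`), `contDiff_profile_norm`, `ofProfile`, unfolding lemmas.

Design notes. (1) Why a new structure rather than `ShortRangePotential`: its field
`tendsto_zero : φ → +∞ at 0⁺` excludes bounded cores, and `PotentialFlow` is only a.e. defined;
for a bounded `C²` potential the vector field `(v, -∇U)` is globally Lipschitz on
`(X × ℝ^d)^N` for the two concrete geometries (`Torus.geometry`, `ε < ½`; `Euclidean.geometry`),
so an `∀ z` flow exists and is unique — for an ABSTRACT `Geometry` (where `sepVec` is unrelated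
to `translate`, see the design notes of `PotentialDynamics.lean`) the structure is a hypothesis
structure that may be empty or non-unique, exactly like `PotentialFlow`. (2) No sign / monotonicity
is imposed on `W` (the route adds `Antitone ψ`, `ψ = 1` on the core, as separate hypotheses; the
weak-coupling Landau literature — Bobylev–Pulvirenti–Saffirio 2013, Catapano 2018 — uses smooth
short-range potentials of either sign). (3) `[cite]`s: the Newtonian `N`-body system with a
smooth finite-range pair potential and its Liouville flow are textbook (Spohn 1991, §I.6 /
Part I Ch. 2; Cercignani–Illner–Pulvirenti 1994, §4.2); tags are `[folklore]`.

## References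

* H. Spohn, *Large Scale Dynamics of Interacting Particles*, Springer (1991), Part I (Newtonian
  dynamics of `N` particles with a smooth pair potential; Liouville measure). [Spohn1991]
* C. Cercignani, R. Illner, M. Pulvirenti, *The Mathematical Theory of Dilute Gases* (1994), §4.2.
* A. V. Bobylev, M. Pulvirenti, C. Saffirio, *From particle systems to the Landau equation: a
  consistency result*, Comm. Math. Phys. 319 (2013) 683–702 (smooth short-range potentials,
  weak coupling). [BobylevPulvirentiSaffirio2013]
-/

open MeasureTheory Metric Set Filter Topology
open scoped InnerProductSpace ENNReal

namespace Literature.Analysis.FunctionSpaces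

noncomputable section

section Kinetic

variable {d : Type*} [Fintype d] {X : Type*} {N : ℕ}

/-! ## Bounded `C²` radial pair potentials -/

/-- A **soft (bounded, `C²`, radial, finite-range) pair potential** in dimension `d`:
`W : ℝ^d → ℝ` of class `C²` on the whole space, radial, and vanishing outside the unit ball
(range `1`; the range-`ε` potential is `W.scaled ε`). Boundedness follows (`exists_bound`).
Companion of `ShortRangePotential` (singular core) for soft spheres / soft shoulders
(Spohn 1991, Part I: Newtonian dynamics with a smooth finite-range pair potential). [folklore] -/
structure SoftPotential (d : Type*) [Fintype d] where
  /-- The pair potential `W : ℝ^d → ℝ`. -/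
  W : EuclideanSpace ℝ d → ℝ
  /-- `W` is twice continuously differentiable on all of `ℝ^d` (no singular core). -/
  contDiff : ContDiff ℝ 2 W
  /-- `W` is radial. -/
  radial : ∀ x y, ‖x‖ = ‖y‖ → W x = W y
  /-- Finite range `1`: `W x = 0` for `1 ≤ |x|`. -/
  eq_zero_of_one_le : ∀ x, 1 ≤ ‖x‖ → W x = 0

namespace SoftPotential

/-- The range-`ε` potential `W_ε(x) = W(x / ε)`. [folklore] -/
def scaled (W : SoftPotential d) (ε : ℝ) (x : EuclideanSpace ℝ d) : ℝ := W.W (ε⁻¹ • x)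

/-- Unfolding lemma for `scaled`. [folklore] -/
theorem scaled_apply (W : SoftPotential d) (ε : ℝ) (x : EuclideanSpace ℝ d) :
    W.scaled ε x = W.W (ε⁻¹ • x) := rfl

/-- At scale `1` the scaled potential is `W` itself. [folklore] -/
@[simp] theorem scaled_one (W : SoftPotential d) : W.scaled 1 = W.W := by
  funext x; simp [scaled]

/-- `W` is continuous. [folklore] -/
theorem continuous (W : SoftPotential d) : Continuous W.W := W.contDiff.continuous

/-- `W` vanishes at every point of norm `≥ 1`, so it is determined by its values on the closed
unit ball; in particular **`W` is bounded**. [folklore] -/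
theorem exists_bound (W : SoftPotential d) : ∃ C : ℝ, ∀ x, |W.W x| ≤ C := by
  obtain ⟨C, hC⟩ := (isCompact_closedBall (0 : EuclideanSpace ℝ d) 1).exists_bound_of_continuousOn
    W.continuous.continuousOn
  refine ⟨max C 0, fun x => ?_⟩
  by_cases hx : ‖x‖ ≤ 1
  · exact (Real.norm_eq_abs _ ▸ hC x (by simpa using hx)).trans (le_max_left _ _)
  · rw [W.eq_zero_of_one_le x (le_of_not_ge hx), abs_zero]
    exact le_max_right _ _

/-- Beyond range `ε > 0` the scaled potential vanishes: `W_ε x = 0` for `ε ≤ |x|`. [folklore] -/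
theorem scaled_eq_zero (W : SoftPotential d) {ε : ℝ} (hε : 0 < ε) {x : EuclideanSpace ℝ d}
    (hx : ε ≤ ‖x‖) : W.scaled ε x = 0 := by
  refine W.eq_zero_of_one_le _ ?_
  rw [norm_smul, norm_inv, Real.norm_of_nonneg hε.le]
  exact (one_le_inv_mul₀ hε).2 hx

/-- The scaled potential of a positive scale is again `C²`. [folklore] -/
theorem contDiff_scaled (W : SoftPotential d) (ε : ℝ) : ContDiff ℝ 2 (W.scaled ε) :=
  W.contDiff.comp (contDiff_const_smul ε⁻¹)

end SoftPotential

/-! ### Building a soft potential from a radial profile constant near the origin -/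

/-- **A `C²` profile constant near `0` gives a `C²` radial function**: if `ψ : ℝ → ℝ` is `C²` and
`ψ r = ψ 0` for `r ≤ a` (`a > 0`), then `x ↦ c · ψ |x|` is `C²` on `ℝ^d` (away from `0` the norm
is smooth; near `0` the function is constant). This is the situation of the route's shoulder
profiles (`ψ = 1` on `[0, ½]`). [folklore] -/
theorem contDiff_profile_norm {ψ : ℝ → ℝ} (hψ : ContDiff ℝ 2 ψ) {a : ℝ} (ha : 0 < a)
    (h0 : ∀ r, r ≤ a → ψ r = ψ 0) (c : ℝ) :
    ContDiff ℝ 2 fun x : EuclideanSpace ℝ d => c * ψ ‖x‖ := by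
  refine contDiff_const.mul (contDiff_iff_contDiffAt.2 fun x => ?_)
  by_cases hx : x = 0
  · subst hx
    have hev : (fun y : EuclideanSpace ℝ d => ψ ‖y‖) =ᶠ[𝓝 0] fun _ => ψ 0 := by
      filter_upwards [Metric.ball_mem_nhds (0 : EuclideanSpace ℝ d) ha] with y hy
      exact h0 _ (le_of_lt (by simpa using hy))
    exact contDiffAt_const.congr_of_eventuallyEq hev
  · exact hψ.contDiffAt.comp x (contDiffAt_norm ℝ hx)

/-- **The soft potential `W(x) = c · ψ(|x|)` of a `C²` profile `ψ`** which is constant on `[0, a]`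
(`a > 0`) and vanishes on `[1, ∞)` (e.g. the route's soft shoulder `h · ψ`, `ψ = 1` on `[0, ½]`).
[folklore] -/
def SoftPotential.ofProfile (ψ : ℝ → ℝ) (hψ : ContDiff ℝ 2 ψ) (a : ℝ) (ha : 0 < a)
    (h0 : ∀ r, r ≤ a → ψ r = ψ 0) (h1 : ∀ r, 1 ≤ r → ψ r = 0) (c : ℝ) : SoftPotential d where
  W x := c * ψ ‖x‖
  contDiff := contDiff_profile_norm hψ ha h0 c
  radial x y hxy := by simp [hxy]
  eq_zero_of_one_le x hx := by simp [h1 _ hx]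

/-- Unfolding lemma for `ofProfile`. [folklore] -/
@[simp] theorem SoftPotential.ofProfile_W (ψ : ℝ → ℝ) (hψ : ContDiff ℝ 2 ψ) (a : ℝ) (ha : 0 < a)
    (h0 : ∀ r, r ≤ a → ψ r = ψ 0) (h1 : ∀ r, 1 ≤ r → ψ r = 0) (c : ℝ) (x : EuclideanSpace ℝ d) :
    (SoftPotential.ofProfile (d := d) ψ hψ a ha h0 h1 c).W x = c * ψ ‖x‖ := rfl

/-! ## The `N`-body system -/

section NBody

variable (G : FluidPDE.Geometry d X) (W : SoftPotential d) (ε : ℝ)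

/-- The force on particle `i` in the configuration `z`: `F_i(z) = -∑_{j ≠ i} ∇W_ε (x_i - x_j)`
(Newton's equations with the pair potential `W_ε`, unit masses; the gradient exists everywhere
since `W` is `C²`). [folklore] -/
def softForce (z : FluidPDE.Config N d X) (i : Fin N) : EuclideanSpace ℝ d :=
  -∑ j ∈ Finset.univ.erase i, gradient (W.scaled ε) (G.sepVec (z.pos i) (z.pos j))

/-- The Hamiltonian `H_N(z) = ½ ∑_i |v_i|² + ∑_{i<j} W_ε(x_i - x_j)`. [folklore] -/
def softEnergy (z : FluidPDE.Config N d X) : ℝ :=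
  FluidPDE.configEnergy z +
    ∑ i, ∑ j ∈ Finset.univ.filter (fun j => i < j), W.scaled ε (G.sepVec (z.pos i) (z.pos j))

/-- `γ : ℝ → Config N d X` is a **Newtonian (soft-sphere) trajectory** of the `N`-body system with
pair potential `W_ε` in the geometry `G`: each velocity is differentiable with derivative the
force, `v̇_i = F_i(γ t)`, and each position is the initial position translated by the integrated
velocity, `x_i(t) = x_i(0) + ∫₀ᵗ v_i(s) ds` (positions live in an abstract `X`, e.g. `T^d`,
where `HasDerivAt` is unavailable; same shape as `IsHamiltonianTrajectory`). [folklore] -/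
structure IsSoftTrajectory (N : ℕ) (γ : ℝ → FluidPDE.Config N d X) : Prop where
  /-- Newton's law `v̇_i(t) = F_i(γ(t))`. -/
  vel_hasDerivAt : ∀ t i, HasDerivAt (fun s => (γ s).vel i) (softForce G W ε (γ t) i) t
  /-- `x_i(t) = x_i(0) + ∫₀ᵗ v_i`. -/
  pos_eq : ∀ t i, (γ t).pos i = G.translate ((γ 0).pos i) (∫ s in (0 : ℝ)..t, (γ s).vel i)

/-! ## The flow -/

/-- **The soft-sphere flow**: an everywhere-defined family `flow t : Config N d X → Config N d X`,
`t ∈ ℝ`, with `flow 0 = id`, all of whose orbits `t ↦ flow t z` are Newtonian trajectories of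
the `N`-body system with the bounded `C²` pair potential `W_ε` in the geometry `G` — exactly
the three axioms which the rungs of route `SoftShoulderLandauDial` inline for their families
`Ψ_N`. For the concrete geometries (`Euclidean.geometry d`; `Torus.geometry d` with `ε < ½`)
such a flow exists, is unique, is a measurable group and preserves the Liouville measure
(Cauchy–Lipschitz with a bounded globally Lipschitz force; Liouville) — standard theorems NOT
bundled here and not vendored in this file; for an abstract `Geometry` this is a hypothesis
structure, possibly empty or non-unique (cf. the design notes of `PotentialFlow`).
(Spohn 1991, Part I; Cercignani–Illner–Pulvirenti 1994, §4.2.) [folklore] -/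
structure SoftSphereFlow (N : ℕ) where
  /-- The flow map `(t, z) ↦ Ψ_t z`. -/
  flow : ℝ → FluidPDE.Config N d X → FluidPDE.Config N d X
  /-- `Ψ_0 = id`. -/
  flow_zero : ∀ z, flow 0 z = z
  /-- Every orbit is a Newtonian trajectory. -/
  isTrajectory : ∀ z, IsSoftTrajectory G W ε N fun t => flow t z

namespace SoftSphereFlow

variable {G W ε}

/-- A soft-sphere flow coerces to its flow map. [folklore] -/
instance instCoeFun :
    CoeFun (SoftSphereFlow G W ε N) fun _ => ℝ → FluidPDE.Config N d X → FluidPDE.Config N d X :=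
  ⟨SoftSphereFlow.flow⟩

/-- Newton's law along the flow (restatement of the field). [folklore] -/
theorem vel_hasDerivAt (Ψ : SoftSphereFlow G W ε N) (z : FluidPDE.Config N d X) (t : ℝ) (i : Fin N) :
    HasDerivAt (fun s => (Ψ.flow s z).vel i) (softForce G W ε (Ψ.flow t z) i) t :=
  (Ψ.isTrajectory z).vel_hasDerivAt t i

/-- Positions along the flow are the initial positions translated by the integrated velocities.
[folklore] -/
theorem pos_eq (Ψ : SoftSphereFlow G W ε N) (z : FluidPDE.Config N d X) (t : ℝ) (i : Fin N) :
    (Ψ.flow t z).pos i = G.translate (z.pos i) (∫ s in (0 : ℝ)..t, (Ψ.flow s z).vel i) := by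
  have h := (Ψ.isTrajectory z).pos_eq t i
  simpa only [Ψ.flow_zero] using h

/-- Transport of a real observable along the flow: `(S_t F)(z) = F (Ψ_{-t} z)`. [folklore] -/
def transportFn (Ψ : SoftSphereFlow G W ε N) (F : FluidPDE.Config N d X → ℝ) (t : ℝ) :
    FluidPDE.Config N d X → ℝ :=
  fun z => F (Ψ.flow (-t) z)

/-- Unfolding lemma for `transportFn`. [folklore] -/
@[simp] theorem transportFn_apply (Ψ : SoftSphereFlow G W ε N) (F : FluidPDE.Config N d X → ℝ)
    (t : ℝ) (z : FluidPDE.Config N d X) : Ψ.transportFn F t z = F (Ψ.flow (-t) z) := rfl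

variable [MeasureSpace X]

/-- The law at time `t` of the system started from the initial law `P₀`: `(Ψ_t)_* P₀`. [folklore] -/
def lawAt (Ψ : SoftSphereFlow G W ε N) (P₀ : Measure (FluidPDE.Config N d X)) (t : ℝ) :
    Measure (FluidPDE.Config N d X) :=
  P₀.map (Ψ.flow t)

/-- Unfolding lemma for `lawAt`. [folklore] -/
@[simp] theorem lawAt_eq (Ψ : SoftSphereFlow G W ε N) (P₀ : Measure (FluidPDE.Config N d X)) (t : ℝ) :
    Ψ.lawAt P₀ t = P₀.map (Ψ.flow t) := rfl

end SoftSphereFlow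

/-! ### Non-vacuity: the zero potential and free flight -/

/-- The zero potential (no interaction). [folklore] -/
def SoftPotential.zero : SoftPotential d where
  W _ := 0
  contDiff := contDiff_const
  radial _ _ _ := rfl
  eq_zero_of_one_le _ _ := rfl

/-- The zero potential exerts no force. [folklore] -/
theorem softForce_zero (z : FluidPDE.Config N d X) (i : Fin N) :
    softForce G (SoftPotential.zero (d := d)) ε z i = 0 := by
  have h : (SoftPotential.zero (d := d)).scaled ε = fun _ => (0 : ℝ) := rfl
  simp [softForce, h]

/-- **Free flight is a soft-sphere flow for the zero potential** (in any geometry): positions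
translate linearly, velocities are constant — so the structure `SoftSphereFlow` is inhabited.
[folklore] -/
def SoftSphereFlow.free (N : ℕ) : SoftSphereFlow G (SoftPotential.zero (d := d)) ε N where
  flow t z := fun i => (G.translate (z i).1 (t • (z i).2), (z i).2)
  flow_zero z := by
    funext i
    simp
  isTrajectory z :=
    { vel_hasDerivAt := fun t i => by
        simpa [softForce_zero] using hasDerivAt_const t ((z i).2)
      pos_eq := fun t i => by
        simp [intervalIntegral.integral_const] }

end NBody

end Kinetic

end

end Literature.Analysis.FunctionSpaces
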